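import Literature.Analysis.FluidPDE.NormalisedPressureDischarge
import Literature.Analysis.FluidPDE.NormalisedPressureLpClass
import Literature.Analysis.FluidPDE.TaoLocalisationProofs
import HarnessLib

/-!
# On Tao's `L²`-Sobolev class the pressure IS the normalised pressure (a.e. in time)

Analysis/FluidPDE proof file (theorems only: no definition, no named fact, no `sorry`).
Search for candidate a priori estimates; no regularity claim. Tao 2013, Lemma 4.1 (i)
(`Literature.Analysis.FluidPDE.tao_pressure_normalisation`, PROVED in the tree as
`tao_pressure_normalisation_holds`) says that for a classical finite-energy solution on a slab
`[0, T] × ℝ³` the pressure is, for a.e. `t`, the normalised (Riesz) pressure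
`ϖ(t) = normalisedPressure (u t)` up to a constant `C(t)`. If in addition the pressure slices are
square integrable — as they are in Tao's smooth `H¹` class (`p(t) ∈ H^k` for all `k`) — the
constant vanishes: `ϖ(t) ∈ L²` by the Calderón–Zygmund bound `‖ϖ‖₂ ≲ ‖u‖₄²`
(`exists_eLpNorm_normalisedPressure_le_sq`, `u(t) ∈ L² ∩ L^∞ ⊂ L⁴`), and a nonzero constant is not
in `L²(ℝ³)` (`memLp_const_iff`, `measure_univ_of_isAddLeftInvariant`). Consequently every `L^p`
statement about the normalised pressure (Stein's bounds, the pressure regularity criteria of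
Berselli–Galdi / Zhou written for `ϖ`) applies verbatim to the pressure of a Tao-class solution
for a.e. time — the transfer step of the assembly of
`Literature.Analysis.FluidPDE.pressureGradientCriterion`.

## References

* [Tao2011] T. Tao, *Localisation and compactness properties of the Navier–Stokes global
  regularity problem*, Anal. PDE 6 (2013) — Lemma 4.1 (i).
* [LemarieRieusset2016] P. G. Lemarié-Rieusset, *The Navier–Stokes problem in the 21st century*,
  CRC Press 2016 — §11.5, Prop. 11.7 (the criterion is stated for the normalised pressure `ϖ`).
-/

noncomputable section

open MeasureTheory Set Function Filter Topology
open scoped ENNReal NNReal ContDiff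

namespace Literature.Analysis.FluidPDE

/-- **A bounded `L²` slice is in `L⁴`**: for a continuous `v : ℝ³ → ℝ³` with `‖v‖ ≤ B` and
`∫‖v‖² < ∞`, `v ∈ L⁴` (`∫‖v‖⁴ ≤ B²∫‖v‖²`). [folklore] -/
private theorem memLp_four_of_bound_of_lintegral_sq
    {v : EuclideanSpace ℝ (Fin 3) → EuclideanSpace ℝ (Fin 3)} (hv : Continuous v) {B : ℝ}
    (hB : ∀ x, ‖v x‖ ≤ B) (hv2 : ∫⁻ x, ‖v x‖ₑ ^ 2 < ⊤) : MemLp v 4 volume := by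
  refine ⟨hv.aestronglyMeasurable, ?_⟩
  have h4 : ∫⁻ x, ‖v x‖ₑ ^ 4 < ⊤ := by
    have hpt : ∀ x, ‖v x‖ₑ ^ 4 ≤ ENNReal.ofReal (B ^ 2) * ‖v x‖ₑ ^ 2 := by
      intro x
      have h1 : ‖v x‖ₑ ^ 2 ≤ ENNReal.ofReal (B ^ 2) := by
        rw [← ofReal_norm, ← ENNReal.ofReal_pow (norm_nonneg _)]
        exact ENNReal.ofReal_le_ofReal (pow_le_pow_left₀ (norm_nonneg _) (hB x) 2)
      calc ‖v x‖ₑ ^ 4 = ‖v x‖ₑ ^ 2 * ‖v x‖ₑ ^ 2 := by ring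
        _ ≤ ENNReal.ofReal (B ^ 2) * ‖v x‖ₑ ^ 2 := mul_le_mul_left h1 _
    calc ∫⁻ x, ‖v x‖ₑ ^ 4 ≤ ∫⁻ x, ENNReal.ofReal (B ^ 2) * ‖v x‖ₑ ^ 2 := lintegral_mono hpt
      _ = ENNReal.ofReal (B ^ 2) * ∫⁻ x, ‖v x‖ₑ ^ 2 := lintegral_const_mul' _ _ ENNReal.ofReal_ne_top
      _ < ⊤ := ENNReal.mul_lt_top ENNReal.ofReal_lt_top hv2
  rw [eLpNorm_lt_top_iff_lintegral_rpow_enorm_lt_top (by norm_num) (by norm_num)]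
  have h4r : (4 : ℝ≥0∞).toReal = ((4 : ℕ) : ℝ) := by norm_num
  simp_rw [h4r, ENNReal.rpow_natCast]
  exact h4

/-- `∫⁻ ‖g‖ₑ² < ∞` gives `‖g‖_{L²} < ∞`. [folklore] -/
private theorem eLpNorm_two_lt_top_of_lintegral_sq {G : Type*} [NormedAddCommGroup G]
    {g : EuclideanSpace ℝ (Fin 3) → G} (h : ∫⁻ x, ‖g x‖ₑ ^ 2 < ⊤) : eLpNorm g 2 volume < ⊤ := by
  rw [eLpNorm_lt_top_iff_lintegral_rpow_enorm_lt_top two_ne_zero (by simp)]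
  have h2r : (2 : ℝ≥0∞).toReal = ((2 : ℕ) : ℝ) := by norm_num
  simp_rw [h2r, ENNReal.rpow_natCast]
  exact h

/-- **On Tao's class the pressure is the normalised pressure, a.e. in time** (Tao 2013,
Lemma 4.1 (i), plus square integrability). Let `(u, p)` be a classical solution of the unforced
Navier–Stokes system on `[0, T] × ℝ³` (`ν > 0`) whose velocity has all `L²` Sobolev norms
bounded on `[0, T]` and whose pressure slices are square integrable, uniformly on `[0, T]`. Then
for a.e. `t ∈ [0, T]`, `p t = normalisedPressure (u t)` (as functions). Proof: Tao's
normalisation gives `p t = ϖ(t) + C(t)` a.e. in `t`; `ϖ(t) ∈ L²` (`‖ϖ‖₂ ≤ C‖u‖₄²`,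
`u(t) ∈ L² ∩ L^∞`), `p(t) ∈ L²`, so the constant `C(t)` is in `L²(ℝ³)`, hence `0`.
[cite: Tao2011, Lemma 4.1 (i)] -/
theorem ae_pressure_eq_normalisedPressure {ν T : ℝ} (hν : 0 < ν) (hT : 0 < T)
    {u : ℝ → EuclideanSpace ℝ (Fin 3) → EuclideanSpace ℝ (Fin 3)}
    {p : ℝ → EuclideanSpace ℝ (Fin 3) → ℝ} (hsol : FluidPDE.IsClassicalNSSolutionOn (Icc 0 T) ν 0 u p)
    (hu : HasBoundedSobolevNormsOn (Icc 0 T) u)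
    (hp0 : ∃ C : ℝ≥0, ∀ t ∈ Icc 0 T, ∫⁻ x, ‖iteratedFDeriv ℝ 0 (p t) x‖ₑ ^ 2 ≤ C) :
    ∀ᵐ t ∂(volume.restrict (Icc 0 T)), p t = normalisedPressure (u t) := by
  -- finite energy on the slab
  obtain ⟨C₀, hC₀⟩ := hu 0
  have hzero : ∀ {f : EuclideanSpace ℝ (Fin 3) → EuclideanSpace ℝ (Fin 3)} {C' : ℝ≥0},
      (∫⁻ x, ‖iteratedFDeriv ℝ 0 f x‖ₑ ^ 2 ≤ C') → ∫⁻ x, ‖f x‖ₑ ^ 2 ≤ C' := by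
    intro f C' h
    refine (le_of_eq (lintegral_congr fun x => ?_)).trans h
    rw [← ofReal_norm, ← ofReal_norm, norm_iteratedFDeriv_zero]
  have hzero' : ∀ {f : EuclideanSpace ℝ (Fin 3) → ℝ} {C' : ℝ≥0},
      (∫⁻ x, ‖iteratedFDeriv ℝ 0 f x‖ₑ ^ 2 ≤ C') → ∫⁻ x, ‖f x‖ₑ ^ 2 ≤ C' := by
    intro f C' h
    refine (le_of_eq (lintegral_congr fun x => ?_)).trans h
    rw [← ofReal_norm, ← ofReal_norm, norm_iteratedFDeriv_zero]
  have hE : ∃ C : ℝ≥0∞, C < ⊤ ∧ ∀ t ∈ Icc 0 T, ∫⁻ x, ‖u t x‖ₑ ^ 2 ≤ C :=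
    ⟨C₀, ENNReal.coe_lt_top, fun t ht => hzero (hC₀ t ht)⟩
  obtain ⟨Cf, -, -, hae⟩ := tao_pressure_normalisation_holds ν T hν hT u p hsol hE
  -- pointwise velocity bound (Sobolev)
  obtain ⟨B₀, hB₀⟩ := linfty_bound_of_hasBoundedSobolevNormsOn_holds
    (fun t ht => (hsol.contDiff_velocity ht).of_le (by norm_cast)) hu
  obtain ⟨P₀, hP₀⟩ := hp0
  -- Stein's `L²` bound for the normalised pressure
  obtain ⟨CS, hCS⟩ := exists_eLpNorm_normalisedPressure_le_sq (p := 2) (by norm_num) (by simp)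
  have huniv : (volume : Measure (EuclideanSpace ℝ (Fin 3))) univ = ⊤ :=
    measure_univ_of_isAddLeftInvariant _
  have h22 : (2 : ℝ≥0∞) * 2 = 4 := by norm_num
  filter_upwards [hae, ae_restrict_mem measurableSet_Icc] with t ht htI
  -- `u t ∈ L⁴`, hence `ϖ(t) ∈ L²`
  have hu4 : MemLp (u t) 4 volume :=
    memLp_four_of_bound_of_lintegral_sq (hsol.contDiff_velocity htI).continuous (hB₀ t htI)
      ((hzero (hC₀ t htI)).trans_lt ENNReal.coe_lt_top)
  have hu4' : MemLp (u t) (2 * 2) volume := by rw [h22]; exact hu4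
  have hϖ : eLpNorm (normalisedPressure (u t)) 2 volume < ⊤ := by
    have h := hCS (u t) hu4'
    refine lt_of_le_of_lt h (ENNReal.mul_lt_top ENNReal.coe_lt_top ?_)
    exact ENNReal.pow_lt_top hu4'.eLpNorm_lt_top
  -- `p t ∈ L²`
  have hpc : Continuous (p t) := (hsol.contDiff_pressure htI).continuous
  have hp2 : MemLp (p t) 2 volume :=
    ⟨hpc.aestronglyMeasurable,
      eLpNorm_two_lt_top_of_lintegral_sq ((hzero' (hP₀ t htI)).trans_lt ENNReal.coe_lt_top)⟩
  -- the normalised pressure is `p t - C t`, hence continuous and in `L²`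
  have hϖeq : normalisedPressure (u t) = fun x => p t x - Cf t := by
    funext x; rw [ht x]; ring
  have hϖ2 : MemLp (normalisedPressure (u t)) 2 volume := by
    refine ⟨?_, hϖ⟩
    rw [hϖeq]
    exact (hpc.sub continuous_const).aestronglyMeasurable
  -- the constant is in `L²(ℝ³)`, hence zero
  have hconst : MemLp (fun _ : EuclideanSpace ℝ (Fin 3) => Cf t) 2 volume := by
    refine (hp2.sub hϖ2).ae_eq (Eventually.of_forall fun x => ?_)
    rw [Pi.sub_apply, hϖeq]
    ring
  rcases (memLp_const_iff two_ne_zero (by simp)).1 hconst with h0 | hfin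
  · funext x; rw [ht x, h0, add_zero]
  · exact absurd hfin (by rw [huniv]; exact lt_irrefl _)

end Literature.Analysis.FluidPDE

end
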